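import Literature.NumberTheory.Sieve.BrunPureSieve
import Mathlib.Data.Nat.Totient
import Mathlib.Data.Nat.Squarefree
import Mathlib.Data.Nat.Factorial.Basic
import Mathlib.Data.Nat.GCD.BigOperators
import Mathlib.Data.Nat.Cast.Order.Field
import Mathlib.Algebra.BigOperators.Group.Finset.Powerset
import HarnessLib

/-!
# Pure-sieve exactness in a window: the oscillation input for the uncertainty principle for
# subsets of the primes

Support file for `Literature/Barriers/Parity/EquidistributionLimitsProofs.lean` (discharge of
`Literature.Barriers.Parity.EquidistributionLimitBarrier`, Granville–Soundararajan 2007, Example 4).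
In Granville–Soundararajan's framework the Maier matrix (their Proposition 2.2) reduces the
irregularity of a sequence in arithmetic progressions to an oscillation of the mean value of the
multiplicative function `f_q`; for a SUBSET OF THE PRIMES `f_q(n) = 1_{(n,q)=1}` (their Example 2:
`h(p) = 0`, `γ_q = φ(q)/q`), so the mean value in question is the proportion of integers `j ≤ J`
coprime to `q`, compared with `φ(q)/q` [cite: GranvilleSoundararajan2007Uncertainty, §2 Proposition 2.2 and Example 2].
Instead of the general oscillation theorem (their Corollary 3.2) we use an exact evaluation: if
`q = ∏_{p ∈ P} p` with every `p ∈ P` larger than `w` and `J ≤ w^{N+1}`, then in Legendre's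
identity `Φ(J; P) = ∑_{T ⊆ P} (-1)^{#T} ⌊J/∏T⌋` all terms with `#T ≥ N + 1` vanish, so
`Φ(J; P) = J · T_N + O((#P+1)^N)` with the TRUNCATED Euler product
`T_N = ∑_{k ≤ N} (-1)^k e_k(1/p : p ∈ P)`, while `φ(q)/q = ∏ (1 - 1/p)` is the full product; by the
Bonferroni inequalities (tree: `Literature.NumberTheory.Sieve.BrunPureSieve`) and the recursion
`(k+1) e_{k+1} = ∑_{#S = k} (∏_S 1/p)(∑_{p ∉ S} 1/p)` the difference is at least
`e_{N+1} - e_{N+2} ≥ e_{N+1}/2 ≥ (s - (N+1)/w)^{N+1} / (2 (N+1)!)`, `s = ∑_{p ∈ P} 1/p ≤ 1`.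
This is Brun's pure sieve run "exactly" (Cojocaru–Murty §6.1) [cite: CojocaruMurty2005, §6.1 (6.1)–(6.5)].

## Contents (all proved; no definitions — the file uses local notations only)

* `Φ(J; P) = #{1 ≤ j ≤ J : p ∤ j ∀ p ∈ P}` (local notation), the Legendre sum `Λ(J; P)`,
  Legendre's identity `roughCount_eq_legendreSum` (induction on `P`:
  `Φ(J; P ∪ {p}) = Φ(J; P) - Φ(⌊J/p⌋; P)`).
* `e(P, k) = e_k(1/p : p ∈ P)`, `T(P, N) = T_N` (local notations); the window estimate
  `abs_roughCount_sub_mul_truncEuler_le`; the recursion `succ_mul_invEsymm_succ` with the bounds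
  `invEsymm_succ_le`, `le_invEsymm_succ`, `pow_div_factorial_le_invEsymm`; the Bonferroni deviation
  `invEsymm_sub_le_abs_truncEuler_sub_prod`; and the assembled `roughCount_deviation`.
* `totient_prod_primes_div`: `φ(∏ p)/∏ p = ∏ (1 - 1/p)`; `coprime_prod_primes_iff`.

## References

* A. Granville, K. Soundararajan, *An uncertainty principle for arithmetic sequences*, Ann. of
  Math. 165 (2007), 593–635, §2 (Proposition 2.2), Example 2, Example 4. [GranvilleSoundararajan2007Uncertainty]
* A. C. Cojocaru, M. R. Murty, *An Introduction to Sieve Methods and their Applications*, CUP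
  2005, §6.1 (Brun's pure sieve). [CojocaruMurty2005]
-/

noncomputable section

open Finset

namespace Literature.Barriers.Parity

/-! ### Rough numbers and Legendre's identity -/

/-- `Φ(J; P) = #{1 ≤ j ≤ J : p ∤ j for every p ∈ P}`: the integers up to `J` with no prime factor
from the finite set `P` (for `P` a set of primes, the `j ≤ J` coprime to `∏_{p ∈ P} p`). -/
local notation3 "Φ(" J "; " P ")" =>
  Finset.card (Finset.filter (fun j => ∀ p ∈ P, ¬ p ∣ j) (Finset.Icc 1 J))

/-- Legendre's alternating sum `Λ(J; P) = ∑_{T ⊆ P} (-1)^{#T} ⌊J / ∏_{p ∈ T} p⌋`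
(Cojocaru–Murty §6.1 (6.5)). -/
local notation3 "Λ(" J "; " P ")" =>
  ∑ T ∈ Finset.powerset P, (-1 : ℤ) ^ (Finset.card T) * ((J / ∏ p ∈ T, p : ℕ) : ℤ)

/-- `e(P, k) = ∑_{S ⊆ P, #S = k} ∏_{p ∈ S} 1/p`, the `k`-th elementary symmetric function of the
reciprocals. -/
local notation3 "e(" P ", " k ")" => ∑ S ∈ Finset.powersetCard k P, ∏ p ∈ S, ((p : ℕ) : ℝ)⁻¹

/-- The truncated Euler product `T(P, N) = ∑_{k ≤ N} (-1)^k e(P, k)` (Brun's truncation of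
`∏_{p ∈ P} (1 - 1/p) = ∑_k (-1)^k e_k`, Cojocaru–Murty §6.1 (6.4)). -/
local notation3 "T(" P ", " N ")" =>
  ∑ k ∈ Finset.range (N + 1), (-1 : ℝ) ^ k * e(P, k)

/-- `Φ(J; ∅) = J`. [folklore] -/
theorem roughCount_empty (J : ℕ) : Φ(J; (∅ : Finset ℕ)) = J := by
  simp

/-- For a set of primes `P`: `j` is coprime to `∏_{p ∈ P} p` iff no `p ∈ P` divides `j`. [folklore] -/
theorem coprime_prod_primes_iff {P : Finset ℕ} (hP : ∀ p ∈ P, p.Prime) (j : ℕ) :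
    Nat.Coprime j (∏ p ∈ P, p) ↔ ∀ p ∈ P, ¬ p ∣ j := by
  rw [Nat.coprime_prod_right_iff]
  refine forall₂_congr fun p hp => ?_
  rw [Nat.coprime_comm, (hP p hp).coprime_iff_not_dvd]

/-- The `P`-rough multiples of a further prime `p ∉ P` up to `J` are `p` times the `P`-rough
integers up to `⌊J/p⌋`. [folklore] -/
theorem card_filter_rough_dvd {P : Finset ℕ} {p : ℕ} (hp : p.Prime) (hpP : p ∉ P)
    (hP : ∀ q ∈ P, q.Prime) (J : ℕ) :
    #{j ∈ Icc 1 J | (∀ q ∈ P, ¬ q ∣ j) ∧ p ∣ j} = Φ(J / p; P) := by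
  symm
  refine Finset.card_nbij' (fun k => p * k) (fun j => j / p) ?_ ?_ ?_ ?_
  · intro k hk
    simp only [coe_filter, mem_Icc, Set.mem_setOf_eq] at hk ⊢
    obtain ⟨⟨hk1, hkJ⟩, hkr⟩ := hk
    refine ⟨⟨Nat.succ_le_of_lt (Nat.mul_pos hp.pos hk1), ?_⟩, ?_, dvd_mul_right p k⟩
    · rw [mul_comm]; exact (Nat.le_div_iff_mul_le hp.pos).mp hkJ
    · intro q hq hdvd
      rcases (hP q hq).dvd_mul.mp hdvd with h | h
      · exact hpP (((Nat.prime_dvd_prime_iff_eq (hP q hq) hp).mp h) ▸ hq)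
      · exact hkr q hq h
  · intro j hj
    simp only [coe_filter, mem_Icc, Set.mem_setOf_eq] at hj ⊢
    obtain ⟨⟨hj1, hjJ⟩, hjr, hpj⟩ := hj
    refine ⟨⟨?_, Nat.div_le_div_right hjJ⟩, ?_⟩
    · exact (Nat.le_div_iff_mul_le hp.pos).mpr (by simpa using Nat.le_of_dvd hj1 hpj)
    · intro q hq hdvd
      exact hjr q hq (hdvd.trans (Nat.div_dvd_of_dvd hpj))
  · intro k _
    exact Nat.mul_div_cancel_left k hp.pos
  · intro j hj
    simp only [coe_filter, Set.mem_setOf_eq] at hj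
    exact Nat.mul_div_cancel' hj.2.2

/-- Buchstab–Legendre recursion `Φ(J; P ∪ {p}) + Φ(⌊J/p⌋; P) = Φ(J; P)` for a prime `p ∉ P`.
[cite: CojocaruMurty2005, §6.1] -/
theorem roughCount_insert {P : Finset ℕ} {p : ℕ} (hp : p.Prime) (hpP : p ∉ P)
    (hP : ∀ q ∈ P, q.Prime) (J : ℕ) :
    Φ(J; insert p P) + Φ(J / p; P) = Φ(J; P) := by
  rw [← card_filter_rough_dvd hp hpP hP J]
  have h1 : (Icc 1 J).filter (fun j => ∀ q ∈ insert p P, ¬ q ∣ j) =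
      ((Icc 1 J).filter (fun j => ∀ q ∈ P, ¬ q ∣ j)).filter (fun j => ¬ p ∣ j) := by
    rw [filter_filter]
    refine filter_congr fun j _ => ?_
    rw [forall_mem_insert]
    exact and_comm
  have h2 : (Icc 1 J).filter (fun j => (∀ q ∈ P, ¬ q ∣ j) ∧ p ∣ j) =
      ((Icc 1 J).filter (fun j => ∀ q ∈ P, ¬ q ∣ j)).filter (fun j => p ∣ j) := by
    rw [filter_filter]
  rw [h1, h2, add_comm]
  exact card_filter_add_card_filter_not (fun j => p ∣ j)

/-- The same recursion for the Legendre sum: `L(J; P ∪ {p}) = L(J; P) - L(⌊J/p⌋; P)` (`p ∉ P`;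
uses `⌊⌊J/p⌋/d⌋ = ⌊J/(pd)⌋`). [folklore] -/
theorem legendreSum_insert {P : Finset ℕ} {p : ℕ} (hpP : p ∉ P) (J : ℕ) :
    Λ(J; insert p P) = Λ(J; P) - Λ(J / p; P) := by
  rw [sum_powerset_insert hpP, sub_eq_add_neg, ← sum_neg_distrib]
  congr 1
  refine sum_congr rfl fun T hT => ?_
  have hpT : p ∉ T := fun h => hpP (mem_powerset.mp hT h)
  rw [card_insert_of_notMem hpT, prod_insert hpT, pow_succ, ← Nat.div_div_eq_div_mul]
  ring

/-- **Legendre's identity** (the sieve of Eratosthenes–Legendre, exact form): for a finite set of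
primes `P`, `Φ(J; P) = ∑_{T ⊆ P} (-1)^{#T} ⌊J / ∏_{p ∈ T} p⌋`. [cite: CojocaruMurty2005, §6.1 (6.5)] -/
theorem roughCount_eq_legendreSum {P : Finset ℕ} (hP : ∀ p ∈ P, p.Prime) (J : ℕ) :
    (Φ(J; P) : ℤ) = Λ(J; P) := by
  induction P using Finset.induction_on generalizing J with
  | empty => simp
  | insert p P hpP ih =>
    have hp : p.Prime := hP p (mem_insert_self p P)
    have hP' : ∀ q ∈ P, q.Prime := fun q hq => hP q (mem_insert_of_mem hq)
    rw [legendreSum_insert hpP, ← ih hP' J, ← ih hP' (J / p)]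
    have h := congrArg (Nat.cast : ℕ → ℤ) (roughCount_insert hp hpP hP' J)
    push_cast at h
    linarith

/-! ### Truncation in the window `J < ∏ T` for `#T ≥ N + 1` -/

/-- In the window where every product of `N + 1` or more elements of `P` exceeds `J`, the
Legendre sum is its truncation at level `N`. [folklore] -/
theorem legendreSum_eq_sum_filter {P : Finset ℕ} {J N : ℕ}
    (hW : ∀ T ∈ P.powerset, N + 1 ≤ #T → J < ∏ p ∈ T, p) :
    Λ(J; P) = ∑ T ∈ P.powerset with #T ≤ N, (-1 : ℤ) ^ #T * ((J / ∏ p ∈ T, p : ℕ) : ℤ) := by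
  rw [sum_filter]
  refine sum_congr rfl fun T hT => ?_
  split_ifs with h
  · rfl
  · rw [Nat.div_eq_of_lt (hW T hT (by omega)), Nat.cast_zero, mul_zero]

/-- Regrouping a sum over `{T ⊆ P : #T ≤ N}` by cardinality. [folklore] -/
theorem sum_powerset_filter_card_le {M : Type*} [AddCommMonoid M] (P : Finset ℕ) (N : ℕ)
    (g : Finset ℕ → M) :
    ∑ T ∈ P.powerset with #T ≤ N, g T = ∑ k ∈ range (N + 1), ∑ T ∈ P.powersetCard k, g T := by
  rw [← sum_fiberwise_of_maps_to (s := P.powerset.filter (fun T => #T ≤ N)) (t := range (N + 1))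
    (g := fun T => #T) (fun T hT => mem_range.mpr (Nat.lt_succ_of_le (mem_filter.mp hT).2))]
  refine sum_congr rfl fun k hk => sum_congr ?_ fun _ _ => rfl
  ext T
  simp only [mem_filter, mem_powerset, mem_powersetCard]
  constructor
  · rintro ⟨⟨h1, -⟩, h3⟩
    exact ⟨h1, h3⟩
  · rintro ⟨h1, h2⟩
    exact ⟨⟨h1, h2 ▸ Nat.lt_succ_iff.mp (mem_range.mp hk)⟩, h2⟩

/-- `|⌊J/d⌋ - J/d| ≤ 1` for `d ≥ 1`. [folklore] -/
theorem abs_natCast_div_sub_div_le {J d : ℕ} (hd : 0 < d) :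
    |((J / d : ℕ) : ℝ) - (J : ℝ) / d| ≤ 1 := by
  have h1 : ((J / d : ℕ) : ℝ) ≤ (J : ℝ) / d := Nat.cast_div_le
  have h2 : (J : ℝ) < ((J / d : ℕ) : ℝ) * d + d := by exact_mod_cast Nat.lt_div_mul_add hd
  have hd' : (0 : ℝ) < d := by exact_mod_cast hd
  have h3 : (J : ℝ) / d < ((J / d : ℕ) : ℝ) + 1 := by
    rw [div_lt_iff₀ hd']
    linarith
  rw [abs_le]
  constructor <;> linarith

/-- **Pure-sieve exactness in the window**: if every product of at least `N + 1` elements of the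
set of primes `P` exceeds `J`, then `|Φ(J; P) - J · T_N(P)| ≤ (#P + 1)^N`.
[cite: CojocaruMurty2005, §6.1 (6.5)] -/
theorem abs_roughCount_sub_mul_truncEuler_le {P : Finset ℕ} (hP : ∀ p ∈ P, p.Prime) {J N : ℕ}
    (hW : ∀ T ∈ P.powerset, N + 1 ≤ #T → J < ∏ p ∈ T, p) :
    |(Φ(J; P) : ℝ) - J * T(P, N)| ≤ ((#P : ℝ) + 1) ^ N := by
  have h1 : (Φ(J; P) : ℝ) = ∑ k ∈ range (N + 1), ∑ T ∈ P.powersetCard k,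
      (-1 : ℝ) ^ #T * ((J / ∏ p ∈ T, p : ℕ) : ℝ) := by
    have h := roughCount_eq_legendreSum hP J
    rw [legendreSum_eq_sum_filter hW, sum_powerset_filter_card_le] at h
    have h' := congrArg (Int.cast : ℤ → ℝ) h
    simpa only [Int.cast_natCast, Int.cast_sum, Int.cast_mul, Int.cast_pow, Int.cast_neg,
      Int.cast_one] using h'
  have h2 : (J : ℝ) * T(P, N) = ∑ k ∈ range (N + 1), ∑ T ∈ P.powersetCard k,
      (-1 : ℝ) ^ #T * ((J : ℝ) / ∏ p ∈ T, (p : ℝ)) := by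
    rw [mul_sum]
    refine sum_congr rfl fun k _ => ?_
    rw [mul_sum, mul_sum]
    refine sum_congr rfl fun T hT => ?_
    rw [(mem_powersetCard.mp hT).2, prod_inv_distrib, div_eq_mul_inv]
    ring
  rw [h1, h2, ← sum_sub_distrib]
  calc |∑ k ∈ range (N + 1), (∑ T ∈ P.powersetCard k, (-1 : ℝ) ^ #T * ((J / ∏ p ∈ T, p : ℕ) : ℝ)
          - ∑ T ∈ P.powersetCard k, (-1 : ℝ) ^ #T * ((J : ℝ) / ∏ p ∈ T, (p : ℝ)))|
      ≤ ∑ k ∈ range (N + 1), |∑ T ∈ P.powersetCard k, (-1 : ℝ) ^ #T * ((J / ∏ p ∈ T, p : ℕ) : ℝ)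
          - ∑ T ∈ P.powersetCard k, (-1 : ℝ) ^ #T * ((J : ℝ) / ∏ p ∈ T, (p : ℝ))| :=
        abs_sum_le_sum_abs _ _
    _ ≤ ∑ k ∈ range (N + 1), ((#P).choose k : ℝ) := by
        refine sum_le_sum fun k _ => ?_
        rw [← sum_sub_distrib]
        refine (abs_sum_le_sum_abs _ _).trans ?_
        rw [← card_powersetCard, card_eq_sum_ones (P.powersetCard k), Nat.cast_sum, Nat.cast_one]
        refine sum_le_sum fun T hT => ?_
        have hTp : ∀ p ∈ T, p.Prime := fun p hp => hP p ((mem_powersetCard.mp hT).1 hp)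
        have hd : 0 < ∏ p ∈ T, p := prod_pos fun p hp => (hTp p hp).pos
        rw [← mul_sub, abs_mul, abs_pow, abs_neg, abs_one, one_pow, one_mul, ← Nat.cast_prod]
        exact abs_natCast_div_sub_div_le hd
    _ ≤ ((#P : ℝ) + 1) ^ N :=
        Literature.NumberTheory.Sieve.BrunPureSieve.sum_range_choose_le_pow _ _

/-! ### The elementary symmetric functions of the reciprocals -/

/-- `e_0 = 1`. [folklore] -/
theorem invEsymm_zero (P : Finset ℕ) : e(P, 0) = 1 := by
  simp

/-- `e_1 = s = ∑_{p ∈ P} 1/p`. [folklore] -/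
theorem invEsymm_one (P : Finset ℕ) : e(P, 1) = ∑ p ∈ P, (p : ℝ)⁻¹ := by
  rw [powersetCard_one, sum_map]
  simp

/-- `e_k ≥ 0`. [folklore] -/
theorem invEsymm_nonneg (P : Finset ℕ) (k : ℕ) : 0 ≤ e(P, k) :=
  sum_nonneg fun _ _ => prod_nonneg fun _ _ => by positivity

/-- **The recursion for elementary symmetric functions**:
`(k + 1) e_{k+1} = ∑_{S ⊆ P, #S = k} (∏_{p ∈ S} 1/p) · ∑_{p ∈ P ∖ S} 1/p` (each `(k+1)`-subset
`U` arises from exactly `k + 1` pairs `(U ∖ {p}, p)`). [folklore] -/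
theorem succ_mul_invEsymm_succ (P : Finset ℕ) (k : ℕ) :
    ((k : ℝ) + 1) * e(P, k + 1) =
      ∑ S ∈ P.powersetCard k, (∏ p ∈ S, (p : ℝ)⁻¹) * ∑ p ∈ P \ S, (p : ℝ)⁻¹ := by
  -- both sides as sums over pairs
  have hL : ((k : ℝ) + 1) * e(P, k + 1) =
      ∑ U ∈ P.powersetCard (k + 1), ∑ _p ∈ U, ∏ p ∈ U, (p : ℝ)⁻¹ := by
    rw [mul_sum]
    refine sum_congr rfl fun U hU => ?_
    rw [sum_const, (mem_powersetCard.mp hU).2, nsmul_eq_mul, Nat.cast_add, Nat.cast_one]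
  have hR : ∑ S ∈ P.powersetCard k, (∏ p ∈ S, (p : ℝ)⁻¹) * ∑ p ∈ P \ S, (p : ℝ)⁻¹ =
      ∑ S ∈ P.powersetCard k, ∑ p ∈ P \ S, ∏ p' ∈ insert p S, (p' : ℝ)⁻¹ := by
    refine sum_congr rfl fun S hS => ?_
    rw [mul_sum]
    refine sum_congr rfl fun p hp => ?_
    have hpS : p ∉ S := fun h => (mem_sdiff.mp hp).2 ((mem_powersetCard.mp hS).1 h |> fun _ => h)
    rw [prod_insert hpS, mul_comm]
  rw [hL, hR, sum_sigma', sum_sigma']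
  refine sum_nbij' (fun x => ⟨x.1.erase x.2, x.2⟩) (fun x => ⟨insert x.2 x.1, x.2⟩) ?_ ?_ ?_ ?_ ?_
  · rintro ⟨U, p⟩ hx
    simp only [mem_sigma, mem_powersetCard, mem_sdiff] at hx ⊢
    obtain ⟨⟨hUP, hUc⟩, hpU⟩ := hx
    exact ⟨⟨(erase_subset p U).trans hUP, by rw [card_erase_of_mem hpU, hUc]; rfl⟩, hUP hpU,
      notMem_erase p U⟩
  · rintro ⟨S, p⟩ hx
    simp only [mem_sigma, mem_powersetCard, mem_sdiff] at hx ⊢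
    obtain ⟨⟨hSP, hSc⟩, hpP, hpS⟩ := hx
    exact ⟨⟨insert_subset hpP hSP, by rw [card_insert_of_notMem hpS, hSc]⟩, mem_insert_self p S⟩
  · rintro ⟨U, p⟩ hx
    simp only [mem_sigma, mem_powersetCard] at hx
    simp only [insert_erase hx.2]
  · rintro ⟨S, p⟩ hx
    simp only [mem_sigma, mem_powersetCard, mem_sdiff] at hx
    simp only [erase_insert hx.2.2]
  · rintro ⟨U, p⟩ hx
    simp only [mem_sigma, mem_powersetCard] at hx
    simp only [insert_erase hx.2]

/-- `(k + 1) e_{k+1} ≤ s · e_k` with `s = ∑_{p ∈ P} 1/p`. [folklore] -/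
theorem invEsymm_succ_le (P : Finset ℕ) (k : ℕ) :
    ((k : ℝ) + 1) * e(P, k + 1) ≤ (∑ p ∈ P, (p : ℝ)⁻¹) * e(P, k) := by
  rw [succ_mul_invEsymm_succ, mul_sum]
  refine sum_le_sum fun S hS => ?_
  rw [mul_comm]
  refine mul_le_mul_of_nonneg_right ?_ (prod_nonneg fun _ _ => by positivity)
  exact sum_le_sum_of_subset_of_nonneg sdiff_subset fun _ _ _ => by positivity

/-- `(k + 1) e_{k+1} ≥ (s - k M) e_k` when `1/p ≤ M` on `P`. [folklore] -/
theorem le_invEsymm_succ (P : Finset ℕ) (k : ℕ) {M : ℝ} (hM : ∀ p ∈ P, (p : ℝ)⁻¹ ≤ M) :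
    ((∑ p ∈ P, (p : ℝ)⁻¹) - k * M) * e(P, k) ≤ ((k : ℝ) + 1) * e(P, k + 1) := by
  rw [succ_mul_invEsymm_succ, mul_sum]
  refine sum_le_sum fun S hS => ?_
  obtain ⟨hSP, hSc⟩ := mem_powersetCard.mp hS
  rw [mul_comm]
  refine mul_le_mul_of_nonneg_left ?_ (prod_nonneg fun _ _ => by positivity)
  have hsplit : ∑ p ∈ P \ S, (p : ℝ)⁻¹ + ∑ p ∈ S, (p : ℝ)⁻¹ = ∑ p ∈ P, (p : ℝ)⁻¹ := sum_sdiff hSP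
  have hSle : ∑ p ∈ S, (p : ℝ)⁻¹ ≤ k * M := by
    calc ∑ p ∈ S, (p : ℝ)⁻¹ ≤ ∑ _p ∈ S, M := sum_le_sum fun p hp => hM p (hSP hp)
      _ = k * M := by rw [sum_const, hSc, nsmul_eq_mul]
  linarith

/-- **Lower bound for `e_k`**: if `1/p ≤ M` on `P` and `k M ≤ s`, then `(s - k M)^k / k! ≤ e_k`.
[folklore] -/
theorem pow_div_factorial_le_invEsymm (P : Finset ℕ) {M : ℝ} (hM0 : 0 ≤ M)
    (hM : ∀ p ∈ P, (p : ℝ)⁻¹ ≤ M) :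
    ∀ k : ℕ, (k : ℝ) * M ≤ ∑ p ∈ P, (p : ℝ)⁻¹ →
      ((∑ p ∈ P, (p : ℝ)⁻¹) - k * M) ^ k / (k.factorial : ℝ) ≤ e(P, k) := by
  intro k
  induction k with
  | zero => intro _; simp
  | succ k ih =>
    intro hk
    set s := ∑ p ∈ P, (p : ℝ)⁻¹ with hs
    have hk' : (k : ℝ) * M ≤ s := by
      have : (k : ℝ) * M ≤ ((k : ℝ) + 1) * M := by nlinarith
      exact this.trans (by exact_mod_cast hk)
    have h0 : 0 ≤ s - ((k : ℝ) + 1) * M := by push_cast at hk; linarith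
    have h1 : s - ((k : ℝ) + 1) * M ≤ s - k * M := by nlinarith
    have hrec := le_invEsymm_succ P k hM
    have hih := ih hk'
    have hkpos : (0 : ℝ) < (k : ℝ) + 1 := by positivity
    have hfac : ((k + 1).factorial : ℝ) = ((k : ℝ) + 1) * (k.factorial : ℝ) := by
      rw [Nat.factorial_succ]; push_cast; ring
    have hfpos : (0 : ℝ) < (k.factorial : ℝ) := by exact_mod_cast Nat.factorial_pos k
    -- (s - (k+1)M)^{k+1} ≤ (s - kM) (s - kM)^k ≤ (s - kM) k! e_k ≤ k! (k+1) e_{k+1}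
    have h2 : (s - ((k : ℝ) + 1) * M) ^ (k + 1) ≤ (s - k * M) * (s - k * M) ^ k := by
      rw [← pow_succ']
      exact pow_le_pow_left₀ h0 h1 _
    have h3 : (s - k * M) ^ k ≤ (k.factorial : ℝ) * e(P, k) := by
      rwa [div_le_iff₀' hfpos] at hih
    have h4 : (s - k * M) * (s - k * M) ^ k ≤ (k.factorial : ℝ) * (((k : ℝ) + 1) * e(P, k + 1)) :=
      calc (s - k * M) * (s - k * M) ^ k ≤ (s - k * M) * ((k.factorial : ℝ) * e(P, k)) :=
            mul_le_mul_of_nonneg_left h3 (h0.trans h1)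
        _ = (k.factorial : ℝ) * ((s - k * M) * e(P, k)) := by ring
        _ ≤ (k.factorial : ℝ) * (((k : ℝ) + 1) * e(P, k + 1)) :=
            mul_le_mul_of_nonneg_left hrec hfpos.le
    push_cast
    rw [div_le_iff₀ (by rw [hfac]; positivity), hfac]
    calc (s - ((k : ℝ) + 1) * M) ^ (k + 1) ≤ (s - k * M) * (s - k * M) ^ k := h2
      _ ≤ (k.factorial : ℝ) * (((k : ℝ) + 1) * e(P, k + 1)) := h4
      _ = e(P, k + 1) * (((k : ℝ) + 1) * (k.factorial : ℝ)) := by ring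

/-! ### The deviation of the truncated Euler product from the full product -/

/-- **Bonferroni deviation**: `e_{N+1} - e_{N+2} ≤ |T_N - ∏_{p ∈ P} (1 - 1/p)|` (from the upper
Bonferroni inequality at the even level `N + 1`, resp. the lower one at the even level `N + 2`).
[cite: CojocaruMurty2005, §6.1 Lemma 6.1.1] -/
theorem invEsymm_sub_le_abs_truncEuler_sub_prod (P : Finset ℕ) (N : ℕ) :
    e(P, N + 1) - e(P, N + 2) ≤ |T(P, N) - ∏ p ∈ P, (1 - (p : ℝ)⁻¹)| := by
  have h0 : ∀ p ∈ P, (0 : ℝ) ≤ (p : ℝ)⁻¹ := fun _ _ => by positivity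
  have h1 : ∀ p ∈ P, (p : ℝ)⁻¹ ≤ 1 := fun _ _ => Nat.cast_inv_le_one _
  rcases Nat.even_or_odd (N + 1) with hev | hodd
  · -- `T_{N+1} = T_N + e_{N+1} ≤ E + e_{N+2}`
    have hB := Literature.NumberTheory.Sieve.BrunPureSieve.bonferroniSum_le_prod_one_sub_add P
      (fun p => (p : ℝ)⁻¹) h0 h1 hev
    have hT : T(P, N + 1) = T(P, N) + e(P, N + 1) := by
      rw [sum_range_succ, hev.neg_one_pow, one_mul]
    rw [hT] at hB
    have : e(P, N + 1) - e(P, N + 2) ≤ -(T(P, N) - ∏ p ∈ P, (1 - (p : ℝ)⁻¹)) := by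
      linarith
    exact this.trans (neg_le_abs _)
  · have hev : Even (N + 2) := by
      rcases hodd with ⟨m, hm⟩
      exact ⟨m + 1, by omega⟩
    have hB := Literature.NumberTheory.Sieve.BrunPureSieve.prod_one_sub_le_bonferroniSum P
      (fun p => (p : ℝ)⁻¹) h0 h1 hev
    have hT : T(P, N + 2) = T(P, N) - e(P, N + 1) + e(P, N + 2) := by
      rw [sum_range_succ, sum_range_succ, hev.neg_one_pow, hodd.neg_one_pow]
      ring
    rw [hT] at hB
    have : e(P, N + 1) - e(P, N + 2) ≤ T(P, N) - ∏ p ∈ P, (1 - (p : ℝ)⁻¹) := by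
      linarith
    exact this.trans (le_abs_self _)

/-- **The oscillation substitute**: if `s = ∑_{p ∈ P} 1/p ≤ 1`, `1/p ≤ M` on `P` and
`(N + 1) M ≤ s`, then `|T_N - ∏_{p ∈ P}(1 - 1/p)| ≥ (s - (N+1) M)^{N+1} / (2 (N+1)!)`. [folklore] -/
theorem pow_div_le_abs_truncEuler_sub_prod (P : Finset ℕ) (N : ℕ) {M : ℝ} (hM0 : 0 ≤ M)
    (hM : ∀ p ∈ P, (p : ℝ)⁻¹ ≤ M) (hs1 : ∑ p ∈ P, (p : ℝ)⁻¹ ≤ 1)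
    (hNM : ((N : ℝ) + 1) * M ≤ ∑ p ∈ P, (p : ℝ)⁻¹) :
    ((∑ p ∈ P, (p : ℝ)⁻¹) - ((N : ℝ) + 1) * M) ^ (N + 1) / (2 * ((N + 1).factorial : ℝ)) ≤
      |T(P, N) - ∏ p ∈ P, (1 - (p : ℝ)⁻¹)| := by
  set s := ∑ p ∈ P, (p : ℝ)⁻¹ with hs
  have hdev := invEsymm_sub_le_abs_truncEuler_sub_prod P N
  -- `e_{N+2} ≤ s e_{N+1} / (N+2) ≤ e_{N+1} / 2`
  have hsucc := invEsymm_succ_le P (N + 1)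
  have hpos := invEsymm_nonneg P (N + 1)
  have hN2 : (2 : ℝ) ≤ ((N + 1 : ℕ) : ℝ) + 1 := by push_cast; linarith [(Nat.cast_nonneg N : (0 : ℝ) ≤ N)]
  have h2 : 2 * e(P, N + 2) ≤ e(P, N + 1) := by
    have : 2 * e(P, N + 1 + 1) ≤ (((N + 1 : ℕ) : ℝ) + 1) * e(P, N + 1 + 1) :=
      mul_le_mul_of_nonneg_right hN2 (invEsymm_nonneg P _)
    have h' : s * e(P, N + 1) ≤ 1 * e(P, N + 1) :=
      mul_le_mul_of_nonneg_right hs1 hpos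
    linarith
  -- `e_{N+1} ≥ (s - (N+1)M)^{N+1}/(N+1)!`
  have hlow := pow_div_factorial_le_invEsymm P hM0 hM (N + 1) (by push_cast; exact hNM)
  push_cast at hlow
  have hfpos : (0 : ℝ) < ((N + 1).factorial : ℝ) := by exact_mod_cast Nat.factorial_pos _
  rw [div_le_iff₀ (by positivity)]
  rw [div_le_iff₀ hfpos] at hlow
  nlinarith [abs_nonneg (T(P, N) - ∏ p ∈ P, (1 - (p : ℝ)⁻¹))]

/-! ### Assembly: the deviation of `Φ(J; P)` from `J φ(q)/q` -/

/-- For distinct primes, `φ(∏ p) / ∏ p = ∏ (1 - 1/p)`. [folklore] -/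
theorem totient_prod_primes_div {P : Finset ℕ} (hP : ∀ p ∈ P, p.Prime) :
    ((Nat.totient (∏ p ∈ P, p) : ℕ) : ℝ) / ((∏ p ∈ P, p : ℕ) : ℝ) =
      ∏ p ∈ P, (1 - (p : ℝ)⁻¹) := by
  have h := Nat.totient_eq_mul_prod_factors (∏ p ∈ P, p)
  rw [Nat.primeFactors_prod hP] at h
  have h' := congrArg (Rat.cast : ℚ → ℝ) h
  push_cast at h'
  have hpos : (0 : ℝ) < ((∏ p ∈ P, p : ℕ) : ℝ) := by
    exact_mod_cast prod_pos fun p hp => (hP p hp).pos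
  rw [div_eq_iff hpos.ne', h']
  push_cast
  ring

/-- The window hypothesis from a lower bound on the primes: if every `p ∈ P` exceeds `w` and
`J ≤ w^{N+1}`, then every product of at least `N + 1` elements of `P` exceeds `J`. [folklore] -/
theorem window_of_lt {P : Finset ℕ} {w J N : ℕ} (hw : ∀ p ∈ P, w < p) (hJ : J ≤ w ^ (N + 1)) :
    ∀ T ∈ P.powerset, N + 1 ≤ #T → J < ∏ p ∈ T, p := by
  intro T hT hcard
  have hTP := mem_powerset.mp hT
  calc J ≤ w ^ (N + 1) := hJ
    _ < (w + 1) ^ (N + 1) := Nat.pow_lt_pow_left (Nat.lt_succ_self w) (Nat.succ_ne_zero N)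
    _ ≤ (w + 1) ^ #T := Nat.pow_le_pow_right (Nat.succ_pos w) hcard
    _ ≤ ∏ p ∈ T, p := pow_card_le_prod T (fun p => p) (w + 1) fun p hp => hw p (hTP hp)

/-- **Deviation of the rough count from its expectation** (the oscillation input for subsets of
the primes): for a finite set of primes `P` all exceeding `w ≥ 1`, `J ≤ w^{N+1}`,
`s = ∑_{p ∈ P} 1/p ≤ 1` and `(N+1)/w ≤ s`,
`J (s - (N+1)/w)^{N+1} / (2 (N+1)!) - (#P + 1)^N ≤ |Φ(J; P) - J ∏_{p ∈ P} (1 - 1/p)|`.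
[cite: GranvilleSoundararajan2007Uncertainty, §2 (role of Corollary 3.2 in Proposition 2.2, here for `f_q = 1_{(·,q)=1}`)] -/
theorem roughCount_deviation {P : Finset ℕ} (hP : ∀ p ∈ P, p.Prime) {J N w : ℕ} (hw1 : 1 ≤ w)
    (hw : ∀ p ∈ P, w < p) (hJ : J ≤ w ^ (N + 1)) (hs1 : ∑ p ∈ P, (p : ℝ)⁻¹ ≤ 1)
    (hNw : ((N : ℝ) + 1) / w ≤ ∑ p ∈ P, (p : ℝ)⁻¹) :
    (J : ℝ) * (((∑ p ∈ P, (p : ℝ)⁻¹) - ((N : ℝ) + 1) / w) ^ (N + 1) / (2 * ((N + 1).factorial : ℝ)))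
        - ((#P : ℝ) + 1) ^ N ≤
      |(Φ(J; P) : ℝ) - J * ∏ p ∈ P, (1 - (p : ℝ)⁻¹)| := by
  have hw0 : (0 : ℝ) < w := by exact_mod_cast hw1
  have hM : ∀ p ∈ P, (p : ℝ)⁻¹ ≤ (w : ℝ)⁻¹ := fun p hp =>
    inv_anti₀ hw0 (by exact_mod_cast (hw p hp).le)
  have hosc := pow_div_le_abs_truncEuler_sub_prod P N (inv_nonneg.mpr hw0.le) hM hs1
    (by rw [← div_eq_mul_inv]; exact hNw)
  rw [← div_eq_mul_inv] at hosc
  have htrunc := abs_roughCount_sub_mul_truncEuler_le hP (window_of_lt hw hJ) (N := N)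
  have hJ0 : (0 : ℝ) ≤ J := Nat.cast_nonneg J
  -- |Φ - J E| ≥ J |T_N - E| - |Φ - J T_N|
  have key : (J : ℝ) * |T(P, N) - ∏ p ∈ P, (1 - (p : ℝ)⁻¹)| - ((#P : ℝ) + 1) ^ N ≤
      |(Φ(J; P) : ℝ) - J * ∏ p ∈ P, (1 - (p : ℝ)⁻¹)| := by
    rw [← abs_of_nonneg hJ0, ← abs_mul, abs_of_nonneg hJ0, mul_sub]
    have := abs_sub_abs_le_abs_sub ((J : ℝ) * T(P, N) - J * ∏ p ∈ P, (1 - (p : ℝ)⁻¹))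
      ((J : ℝ) * T(P, N) - Φ(J; P))
    rw [abs_sub_comm ((J : ℝ) * T(P, N)) (Φ(J; P) : ℝ)] at this
    have h3 : (J : ℝ) * T(P, N) - J * ∏ p ∈ P, (1 - (p : ℝ)⁻¹) -
        ((J : ℝ) * T(P, N) - Φ(J; P)) =
        (Φ(J; P) : ℝ) - J * ∏ p ∈ P, (1 - (p : ℝ)⁻¹) := by ring
    rw [h3] at this
    linarith
  exact le_trans (by nlinarith) key

end Literature.Barriers.Parity

end
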